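import Summits.BirchSwinnertonDyer.BirchSwinnertonDyer.Theorems.PrintCFramBottomClassIndexLawFiveLeEisensteinAnalyticOfPrint
import HarnessLib

/-!
# Route `PrintCFram`, crux C2 `BottomClassIndexLawFiveLe` (stmt-BirchSwinnertonDyer-20372), line `eisenstein-resource-bdp-line`, skeleton v4:
# the REGULAR LOCUS — the registered stub (AN) `stub_analyticInequality_cmRamified` HOLDS OUTRIGHT at every frame whose residual line has
# TRIVIAL character residual Selmer groups (`λ(X_(∅,0)) = 0` there, so (AN) is vacuous); no congruence, no CGLS Prop. 14 needed
# (cell `bsd-print-cfram`, width seat `bsd-line-cfram-p1-w2` g3; helper `--supports` 20372; ONE theorem, 0 facts, 0 definitions)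

HONEST FRAMING. Nothing about BSD is proved; (AN) is NOT closed in general. By `LambdaResidualBound.pow_lambdaInvariant_empty_le_mul_natCard_residualSelmer_of_line`
(`p^{λ(X_(∅,0))} ≤ #R(Φ)·#R(W[p]/Φ)`), if BOTH residual Selmer groups of the residual line are trivial then `λ(X_(∅,0)(W/K''_∞)) = 0` and the
registered inequality «`∀ m < λ, ‖Q_m‖ < 1`» is vacuous. The residual line of the rational `p`-isogeny, its local clause and (L) are LEAD g4's /
k7r's / X11b's theorems on the CM-ramified class, so the only hypothesis is the triviality of the two character groups
`R_{𝔭'}^S(K''_∞, 𝔽_p(χ))`, `R_{𝔭'}^S(K''_∞, 𝔽_p(χ′))` (the «relative `p`-class number trivial» situation of Kriz–Li 2019 p. 3, in the tower): this is the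
sub-locus of the leaf on which (AN) needs nothing from analysis. BSD is not proved by any of this; no summit statement is proved by this seat.

References: Castella–Grossi–Lee–Skinner 2022 §3 [CastellaGrossiLeeSkinner2022]; Kriz–Li 2019 p. 3 and Thm. 1.20 [KrizLi2019]; Greenberg–Vatsal 2000
§2 [GreenbergVatsal2000].
-/

set_option autoImplicit false
-- the summit namespace `Summit.BirchSwinnertonDyer.BirchSwinnertonDyer` repeats the problem name by design (D-0017)
set_option linter.dupNamespace false

noncomputable section

open scoped Classical

namespace Summit.BirchSwinnertonDyer.BirchSwinnertonDyer.Theorems.PrintCFram.LambdaResidualBound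

open WeierstrassCurve NumberField IsDedekindDomain Field PowerSeries IsLocalRing
  Literature.NumberTheory.EllipticCurves Literature.NumberTheory.EllipticCurves.GreenbergSelmer
  Literature.NumberTheory.EllipticCurves.GreenbergVatsal2000
  Literature.NumberTheory.EllipticCurves.ModularForms
  Literature.NumberTheory.EllipticCurves.Rank1Residual
  Literature.NumberTheory.EllipticCurves.Rank1Residual.Typed
  Literature.NumberTheory.EllipticCurves.IwasawaAlgebra
  Literature.NumberTheory.GaloisRepresentations
  Summit.BirchSwinnertonDyer.Rank1Residual
  Summit.BirchSwinnertonDyer.Rank1Residual.X11b Summit.BirchSwinnertonDyer.Rank1Residual.X11b.AcSelmer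
  Summit.BirchSwinnertonDyer.Rank1Residual.X2.ResidualDevissageModules
  Summit.BirchSwinnertonDyer.BirchSwinnertonDyer.Theorems
  Summit.BirchSwinnertonDyer.BirchSwinnertonDyer.Theorems.SchneiderFree
  Summit.BirchSwinnertonDyer.BirchSwinnertonDyer.Theorems.RamifiedSevenEllipticUnits
  Summit.BirchSwinnertonDyer.BirchSwinnertonDyer.Theorems.PrintCFram
  Summit.BirchSwinnertonDyer.BirchSwinnertonDyer.Theorems.PrintCFram.EisensteinResourceBdpLine
  Summit.BirchSwinnertonDyer.BirchSwinnertonDyer.Theorems.UniversalToricDescentStrictPlace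

/-- **(AN) on the REGULAR LOCUS, outright.** The REGISTERED v4 stub `stub_analyticInequality_cmRamified` (signature verbatim as conclusion) holds
provided that at every frame EVERY `Γ_K`-stable `Φ ≤ W_K[p]` with no non-zero `ker κ ⊓ D_{𝔭'}`-fixed vector in `W_K[p]/Φ` has TRIVIAL residual Selmer
groups `R_{𝔭'}^S(K_∞, Φ)`, `R_{𝔭'}^S(K_∞, W_K[p]/Φ)` at the bad set `S`: then `p^{λ(X_(∅,0))} ≤ 1·1`, `λ = 0`, and «`∀ m < λ, …`» is empty. Line data:
LEAD g4's residual line of the rational `p`-isogeny (`RationalPIsogeny`, `IsogenyLineData`); (L): k7r + X11b; Brink: Literature.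
[cite: CastellaGrossiLeeSkinner2022, §3 Thm. 3.2.1 and Props. 17, 18 (arXiv:2008.02571)] [cite: KrizLi2019, p. 3 and Thm. 1.20] -/
theorem stub_analyticInequality_cmRamified_of_trivial_residualSelmer
    (htriv : ∀ (p : ℕ) [Fact p.Prime] (W : WeierstrassCurve ℚ) [W.IsElliptic] [W.IsGloballyMinimal],
      W.HasCM → CMRamified W p → 5 ≤ p → W.analyticRank = 1 →
      ∀ (N : ℕ) [NeZero N] (K : Type) [Field K] [NumberField K],
      W.conductorNorm ℤ = N → IsImaginaryQuadratic K → SatisfiesHeegnerHypothesis N K →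
      ∀ (κ : ZpExtension K p), κ.IsAnticyclotomic →
        ∀ (𝔭' : HeightOneSpectrum (𝓞 K)), ((p : ℕ) : 𝓞 K) ∈ 𝔭'.asIdeal →
        ∀ (Φ : X2.ResidualDevissageModules.StableSubgroup (absoluteGaloisGroup K) ((W.baseChange K).geomTorsion (p : ℤ))),
          (∀ y : Φ.Quot, (∀ g : ↥(κ.kerSubgroup ⊓ decomp 𝔭'), g • y = y) → y = 0) →
          Nat.card (datumStrictSelmer κ.kerSubgroup Φ.Sub p (AcSelmer.bdpData Φ.Sub p 𝔭')
              {v : HeightOneSpectrum (𝓞 K) | ¬ (W.baseChange K).HasGoodReductionAt v ∧ ((p : ℕ) : 𝓞 K) ∉ v.asIdeal}) = 1 ∧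
          Nat.card (datumStrictSelmer κ.kerSubgroup Φ.Quot p (AcSelmer.bdpData Φ.Quot p 𝔭')
              {v : HeightOneSpectrum (𝓞 K) | ¬ (W.baseChange K).HasGoodReductionAt v ∧ ((p : ℕ) : 𝓞 K) ∉ v.asIdeal}) = 1) :
    ∀ (p : ℕ) [Fact p.Prime] (W : WeierstrassCurve ℚ) [W.IsElliptic] [W.IsGloballyMinimal],
      W.HasCM → CMRamified W p → 5 ≤ p → W.analyticRank = 1 →
      ∀ (N : ℕ) [NeZero N] (K : Type) [Field K] [NumberField K] (Dt : ModularParametrizationData W N),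
      W.conductorNorm ℤ = N → IsImaginaryQuadratic K → SatisfiesHeegnerHypothesis N K →
      ∀ (κ : ZpExtension K p), κ.IsAnticyclotomic → ∀ (γ : Field.absoluteGaloisGroup K) [Fact (κ.IsTopGenerator γ)]
        (𝔭 : HeightOneSpectrum (𝓞 K)), ((p : ℕ) : 𝓞 K) ∈ 𝔭.asIdeal → 𝔭.asIdeal.ramificationIdx (𝓞 ℚ) = 1 →
        𝔭.asIdeal.inertiaDeg (𝓞 ℚ) = 1 → ∀ (𝔭' : HeightOneSpectrum (𝓞 K)), ((p : ℕ) : 𝓞 K) ∈ 𝔭'.asIdeal → 𝔭' ≠ 𝔭 →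
        ∀ (ι' : PadicAlgCl p ≃+* ℂ), SchneiderFree.BranchInducesPrime p ι' 𝔭 →
        ∀ (ΩK : ℂ) (Ωp : ℂ_[p]) (Q : PowerSeries (PadicComplexInt p)), ΩK ≠ 0 → Ωp ≠ 0 →
          R1.IsBDPLFunctionInt p ι' 𝔭 κ γ Dt.f ΩK Ωp Q →
          ∀ m < lambdaInvariant p (XAc (W.baseChange K) p κ 𝔭' ∅ γ),
            ‖((PowerSeries.coeff m Q : PadicComplexInt p) : ℂ_[p])‖ < 1 := by
  intro p _ W _ _ hCM hram h5 hr N _ K _ _ Dt hN hK hHN κ hκ γ _ 𝔭 h𝔭 he hf 𝔭' h𝔭' hne ι' hind ΩK Ωp Q hΩK hΩp hBDP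
  haveI hEK : (W.baseChange K).IsElliptic := inferInstanceAs (W.map (algebraMap ℚ K)).IsElliptic
  have hpr : p.Prime := Fact.out
  have hp2 : p ≠ 2 := by omega
  -- degree one at `𝔭'`, `W(ℚ_p)[p] = 0`, the rational `p`-isogeny and its residual line (LEAD g4)
  have hadd : Addv W p := addv_of_cmRamified W hCM hram h5
  have hpN : p ∣ N := by
    rw [← hN]; exact (W.dvd_conductorNorm_iff_not_hasGoodReductionAtPrime p).mpr hadd.1
  obtain ⟨he', hf'⟩ := degreeOne_of_dvd_of_heegner hK hHN hpN h𝔭'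
  have hW := prime_nsmul_eq_zero_padic_of_hasCM_of_cmRamified W p hCM h5 hram
  obtain ⟨W₁, _, _, -, -, hW₁, g, hg⟩ := RationalPIsogeny.exists_rational_pIsogeny_noPTorsionPadic_of_cmRamified W p hCM h5 hram
  obtain ⟨Φ, -, -, hfix, -, -⟩ := IsogenyLineData.exists_line_clauses_of_isogeny W W₁ p g K hg hW hW₁ κ h𝔭' he' hf'
  -- (L) at `𝔭'`
  have hbot := SchneiderFreeAdditiveX3.fixedPoints_decomp_inf_kerSubgroup_eq_bot_of_noPTorsionPadic W p hW κ 𝔭' h𝔭' he' hf'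
  have hL : ∀ m : (W.baseChange K).geomPrimaryTorsion p,
      (∀ σ ∈ κ.kerSubgroup ⊓ decomp 𝔭', σ • m = m) → p • m = 0 → m = 0 := by
    intro m hm _
    have hmem : m ∈ FixedPoints.addSubgroup ↥(decomp 𝔭' ⊓ κ.kerSubgroup) ((W.baseChange K).geomPrimaryTorsion p) :=
      (FixedPoints.mem_addSubgroup _ _ m).mpr fun d ↦ hm d (by
        obtain ⟨h1, h2⟩ := Subgroup.mem_inf.mp d.2
        exact Subgroup.mem_inf.mpr ⟨h2, h1⟩)
    rw [hbot] at hmem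
    exact (AddSubgroup.mem_bot).mp hmem
  -- trivial residual Selmer groups ⟹ `λ = 0`
  obtain ⟨h1, h2⟩ := htriv p W hCM hram h5 hr N K hN hK hHN κ hκ 𝔭' h𝔭' Φ hfix
  haveI : Finite (datumStrictSelmer κ.kerSubgroup Φ.Sub p (AcSelmer.bdpData Φ.Sub p 𝔭')
      {v : HeightOneSpectrum (𝓞 K) | ¬ (W.baseChange K).HasGoodReductionAt v ∧ ((p : ℕ) : 𝓞 K) ∉ v.asIdeal}) :=
    Nat.finite_of_card_ne_zero (by rw [h1]; exact one_ne_zero)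
  haveI : Finite (datumStrictSelmer κ.kerSubgroup Φ.Quot p (AcSelmer.bdpData Φ.Quot p 𝔭')
      {v : HeightOneSpectrum (𝓞 K) | ¬ (W.baseChange K).HasGoodReductionAt v ∧ ((p : ℕ) : 𝓞 K) ∉ v.asIdeal}) :=
    Nat.finite_of_card_ne_zero (by rw [h2]; exact one_ne_zero)
  have hΦ : (datumStrictSelmer κ.kerSubgroup Φ.Sub p (AcSelmer.bdpData Φ.Sub p 𝔭')
      {v : HeightOneSpectrum (𝓞 K) | ¬ (W.baseChange K).HasGoodReductionAt v ∧ ((p : ℕ) : 𝓞 K) ∉ v.asIdeal} :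
      Set (subgroupH1 κ.kerSubgroup Φ.Sub)).Finite := Set.toFinite _
  have hΨ : (datumStrictSelmer κ.kerSubgroup Φ.Quot p (AcSelmer.bdpData Φ.Quot p 𝔭')
      {v : HeightOneSpectrum (𝓞 K) | ¬ (W.baseChange K).HasGoodReductionAt v ∧ ((p : ℕ) : 𝓞 K) ∉ v.asIdeal} :
      Set (subgroupH1 κ.kerSubgroup Φ.Quot)).Finite := Set.toFinite _
  have h𝔭dec : ¬ (decomp 𝔭' ≤ κ.kerSubgroup) :=
    ZpExtension.not_decomp_le_kerSubgroup_of_isImaginaryQuadratic hK κ (by exact_mod_cast h𝔭')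
  have hlam := pow_lambdaInvariant_empty_le_mul_natCard_residualSelmer_of_line (W.baseChange K) p κ 𝔭' γ hp2 h𝔭' h𝔭dec
    (fun v hv hpv ↦ by by_contra hbad; exact hv ⟨hbad, hpv⟩) Φ hfix hL hΦ hΨ
  rw [h1, h2, mul_one] at hlam
  have hlam0 : lambdaInvariant p (XAc (W.baseChange K) p κ 𝔭' ∅ γ) = 0 := by
    by_contra hne0
    have : p ^ 1 ≤ p ^ lambdaInvariant p (XAc (W.baseChange K) p κ 𝔭' ∅ γ) :=
      Nat.pow_le_pow_right hpr.pos (Nat.one_le_iff_ne_zero.mpr hne0)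
    have := this.trans hlam
    rw [pow_one] at this
    exact absurd this (by omega)
  intro m hm
  rw [hlam0] at hm
  exact absurd hm (Nat.not_lt_zero m)

end Summit.BirchSwinnertonDyer.BirchSwinnertonDyer.Theorems.PrintCFram.LambdaResidualBound

end
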